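import Literature.NumberTheory.Automorphic.MeyerDifferenceRepresentation
import HarnessLib

/-!
# Meyer's global difference representation — proofs: the finite idele units `𝒪̂ˣ` in `C_K`

Topic `NumberTheory/Automorphic`; namespace `Literature.NumberTheory.Automorphic.Meyer`. Sibling
PROOF file of `MeyerDifferenceRepresentation` (Step A of the plan for
`Meyer.spectralRealisation_rat` [Meyer2005, Thm. 5.11]): elementary facts about the compact group
`𝒪̂ˣ = ∏_v 𝒪_vˣ = Meyer.integralFiniteUnits K` of integral finite idele units and its image
`finiteUnitClass` in the idele class group `C_K` [Meyer2005, §5.1]: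

* `Meyer.finIdele K : (𝔸_K^∞)ˣ →* 𝕀_K`, `u ↦ (1, u)` (**definition**), `finiteUnitClass_eq`
  (`finiteUnitClass = mk ∘ finIdele`), `coe_finIdele`, `mul_finIdele_eq`;
* `ideleNorm_finIdele_eq_one`, `classNorm_finiteUnitClass`, **`normChar_finiteUnitClass`** —
  `|(1,u)| = 1` for `u ∈ 𝒪̂ˣ`, so the unramified quasi-characters `|x|^s` are trivial on `𝒪̂ˣ`;
* `integralFiniteUnits_eq_units`, **`isCompact_integralFiniteUnits`** — `𝒪̂ˣ` is the unit group
  of the compact ring `𝒪̂`, hence compact (`Submonoid.units_isCompact`);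
  `finite_quotient_comap_of_isOpen` — an open subgroup has finite index in `𝒪̂ˣ`;
  **`exists_pow_mem_of_isOpen`** — every `u ∈ 𝒪̂ˣ` has a positive power in any open subgroup;
* `exists_openSubgroup_forall` — a simultaneous open subgroup for finitely many open conditions.

Everything is proved; one definition (`finIdele`), no named facts.

## References

* R. Meyer, *On a representation of the idele class group related to primes and zeros of
  L-functions*, Duke Math. J. 127 (2005) = arXiv:math/0311468, §5.1 [Meyer2005].
* A. Weil, *Basic Number Theory* (1967), Ch. IV §3–4 [WeilBNT1967].
-/

noncomputable section

open NumberField IsDedekindDomain Topology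
open scoped NNReal RestrictedProduct

namespace Literature.NumberTheory.Automorphic.Meyer

section FiniteIdele

variable (K : Type) [Field K] [NumberField K]

/-- **The finite ideles** `(𝔸_K^∞)ˣ ↪ 𝕀_K`, `u ↦ (1, u)` (the embedding underlying
`Meyer.finiteUnitClass = mk ∘ finIdele`; companion of `GaloisRepresentations.infiniteIdeles`).
[cite: Meyer2005, §5.1] -/
def finIdele : (FiniteAdeleRing (𝓞 K) K)ˣ →* GaloisRepresentations.ideleGroup K :=
  Units.map (MonoidHom.inr (InfiniteAdeleRing K) (FiniteAdeleRing (𝓞 K) K) :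
    FiniteAdeleRing (𝓞 K) K →* AdeleRing (𝓞 K) K)

variable {K}

/-- `finiteUnitClass u` is the class of the finite idele `(1, u)` (definitional). [folklore] -/
theorem finiteUnitClass_eq (u : (FiniteAdeleRing (𝓞 K) K)ˣ) :
    finiteUnitClass K u = IdeleClassGroup.mk K (finIdele K u) := rfl

/-- Infinite component of the finite idele `(1, u)`: `1` (definitional). [folklore] -/
@[simp]
theorem finIdele_fst (u : (FiniteAdeleRing (𝓞 K) K)ˣ) : (finIdele K u : AdeleRing (𝓞 K) K).1 = 1 := rfl

/-- Finite component of the finite idele `(1, u)`: `u` (definitional). [folklore] -/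
@[simp]
theorem finIdele_snd (u : (FiniteAdeleRing (𝓞 K) K)ˣ) :
    (finIdele K u : AdeleRing (𝓞 K) K).2 = (u : FiniteAdeleRing (𝓞 K) K) := rfl

/-- The finite idele `(1, u)` as a pair (definitional). [folklore] -/
theorem coe_finIdele (u : (FiniteAdeleRing (𝓞 K) K)ˣ) :
    (finIdele K u : AdeleRing (𝓞 K) K) = ((1 : InfiniteAdeleRing K), (u : FiniteAdeleRing (𝓞 K) K)) := rfl

/-- Multiplying an adele by `(1, u)` multiplies its finite component by `u`. [folklore] -/
theorem mul_finIdele_eq (y : AdeleRing (𝓞 K) K) (u : (FiniteAdeleRing (𝓞 K) K)ˣ) :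
    y * (finIdele K u : AdeleRing (𝓞 K) K) = (y.1, y.2 * (u : FiniteAdeleRing (𝓞 K) K)) := by
  rw [coe_finIdele]
  change (y.1 * 1, y.2 * (u : FiniteAdeleRing (𝓞 K) K)) = _
  rw [mul_one]

/-- A local unit has norm `1`: `‖u_v‖ = 1` if `u_v ∈ 𝒪_v` and `u_v⁻¹ ∈ 𝒪_v`. [folklore] -/
theorem nnnorm_apply_eq_one_of_mem {u : (FiniteAdeleRing (𝓞 K) K)ˣ} (hu : u ∈ integralFiniteUnits K)
    (v : HeightOneSpectrum (𝓞 K)) : ‖(u : FiniteAdeleRing (𝓞 K) K) v‖₊ = 1 := by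
  obtain ⟨huv, huv'⟩ := hu v
  have ha : ‖(u : FiniteAdeleRing (𝓞 K) K) v‖₊ ≤ 1 := by
    rw [← NNReal.coe_le_coe, coe_nnnorm, NNReal.coe_one]
    exact Valued.toNormedField.norm_le_one_iff.mpr
      ((HeightOneSpectrum.mem_adicCompletionIntegers (𝓞 K) K v).mp huv)
  have hb : ‖((u⁻¹ : (FiniteAdeleRing (𝓞 K) K)ˣ) : FiniteAdeleRing (𝓞 K) K) v‖₊ ≤ 1 := by
    rw [← NNReal.coe_le_coe, coe_nnnorm, NNReal.coe_one]
    exact Valued.toNormedField.norm_le_one_iff.mpr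
      ((HeightOneSpectrum.mem_adicCompletionIntegers (𝓞 K) K v).mp huv')
  have hab : ‖(u : FiniteAdeleRing (𝓞 K) K) v‖₊ *
      ‖((u⁻¹ : (FiniteAdeleRing (𝓞 K) K)ˣ) : FiniteAdeleRing (𝓞 K) K) v‖₊ = 1 := by
    rw [← nnnorm_mul, ← FiniteAdeleRing.mul_apply', ← Units.val_mul, mul_inv_cancel, Units.val_one]
    change ‖(1 : v.adicCompletion K)‖₊ = 1
    exact nnnorm_one
  exact eq_one_of_one_le_mul_left ha hb hab.ge

/-- **`|(1, u)|_𝔸 = 1` for `u ∈ 𝒪̂ˣ`** (all local factors are `1`). [cite: WeilBNT1967, Ch. IV §4] -/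
theorem ideleNorm_finIdele_eq_one {u : (FiniteAdeleRing (𝓞 K) K)ˣ} (hu : u ∈ integralFiniteUnits K) :
    IdeleClassGroup.ideleNorm K (finIdele K u) = 1 := by
  rw [ideleNorm_apply]
  have hinf : ∀ w : InfinitePlace K, ‖(finIdele K u : AdeleRing (𝓞 K) K).1 w‖₊ = 1 := fun w => by
    have : (finIdele K u : AdeleRing (𝓞 K) K).1 w = 1 := rfl
    rw [this, nnnorm_one]
  simp only [hinf, one_pow, Finset.prod_const_one, one_mul]
  refine finprod_eq_one_of_forall_eq_one fun v => ?_
  exact nnnorm_apply_eq_one_of_mem hu v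

/-- `|finiteUnitClass u| = 1` for `u ∈ 𝒪̂ˣ`. [cite: Meyer2005, §5.1] -/
theorem classNorm_finiteUnitClass {u : (FiniteAdeleRing (𝓞 K) K)ˣ} (hu : u ∈ integralFiniteUnits K) :
    classNorm K (finiteUnitClass K u) = 1 := by
  rw [classNorm, finiteUnitClass_eq, IdeleClassGroup.mk_apply, IdeleClassGroup.norm_mk,
    ideleNorm_finIdele_eq_one hu, NNReal.coe_one]

/-- **The unramified quasi-characters are trivial on `𝒪̂ˣ`**: `|finiteUnitClass u|^s = 1`.
[cite: Meyer2005, §5.1] -/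
theorem normChar_finiteUnitClass (s : ℂ) {u : (FiniteAdeleRing (𝓞 K) K)ˣ} (hu : u ∈ integralFiniteUnits K) :
    normChar K s (finiteUnitClass K u) = 1 := by
  rw [normChar, classNorm_finiteUnitClass hu, Complex.ofReal_one, Complex.one_cpow]

end FiniteIdele

/-! ### Compactness of `𝒪̂ˣ` and finite index of open subgroups -/

section Compact

variable {K : Type} [Field K] [NumberField K]

/-- `𝒪̂ˣ` is the unit group of the subring `𝒪̂ = ∏_v 𝒪_v` of `𝔸_K^∞` (`Submonoid.units`). [folklore] -/
theorem integralFiniteUnits_eq_units :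
    integralFiniteUnits K = (integralFiniteAdeles K).toSubmonoid.units := by
  ext u
  rw [Submonoid.mem_units_iff]
  exact ⟨fun h => ⟨fun v => (h v).1, fun v => (h v).2⟩, fun h v => ⟨h.1 v, h.2 v⟩⟩

/-- **`𝒪̂ˣ = ∏_v 𝒪_vˣ` is compact** (`Submonoid.units_isCompact` on the compact `𝒪̂`,
`FiniteAdeleRing.isCompact_setOf_forall_mem`). [cite: WeilBNT1967, Ch. IV §4] -/
theorem isCompact_integralFiniteUnits :
    IsCompact (integralFiniteUnits K : Set (FiniteAdeleRing (𝓞 K) K)ˣ) := by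
  haveI : ∀ v : HeightOneSpectrum (𝓞 K), CompactSpace (v.adicCompletionIntegers K) :=
    compactSpace_adicCompletionIntegers' K
  haveI : T2Space (FiniteAdeleRing (𝓞 K) K) := inferInstanceAs <| T2Space
    (Πʳ w : HeightOneSpectrum (𝓞 K), [w.adicCompletion K, w.adicCompletionIntegers K])
  rw [integralFiniteUnits_eq_units]
  exact Submonoid.units_isCompact (FiniteAdeleRing.isCompact_setOf_forall_mem (𝓞 K) K)

/-- `𝒪̂ˣ` is a compact group. [folklore] -/
theorem compactSpace_integralFiniteUnits : CompactSpace (integralFiniteUnits K) :=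
  isCompact_iff_compactSpace.mp isCompact_integralFiniteUnits

/-- **An open subgroup has finite index in `𝒪̂ˣ`**: the quotient of the compact group `𝒪̂ˣ` by
the trace of an open subgroup is finite (`Subgroup.quotient_finite_of_isOpen`). [folklore] -/
theorem finite_quotient_comap_of_isOpen (U : OpenSubgroup (FiniteAdeleRing (𝓞 K) K)ˣ) :
    Finite (integralFiniteUnits K ⧸
      (U : Subgroup (FiniteAdeleRing (𝓞 K) K)ˣ).comap (integralFiniteUnits K).subtype) := by
  haveI := compactSpace_integralFiniteUnits (K := K)
  refine Subgroup.quotient_finite_of_isOpen _ ?_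
  exact U.isOpen.preimage continuous_subtype_val

/-- **An integral unit has a positive power in every open subgroup** of the finite idele units
(its class in the finite quotient of `𝒪̂ˣ` by the open subgroup has finite order). [folklore] -/
theorem exists_pow_mem_of_isOpen (U : OpenSubgroup (FiniteAdeleRing (𝓞 K) K)ˣ)
    {u : (FiniteAdeleRing (𝓞 K) K)ˣ} (hu : u ∈ integralFiniteUnits K) :
    ∃ m : ℕ, 0 < m ∧ u ^ m ∈ U := by
  classical
  set C : Subgroup (FiniteAdeleRing (𝓞 K) K)ˣ := integralFiniteUnits K with hC
  set U' : Subgroup C := (U : Subgroup (FiniteAdeleRing (𝓞 K) K)ˣ).comap C.subtype with hU'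
  haveI : Finite (C ⧸ U') := finite_quotient_comap_of_isOpen U
  set m := Nat.card (C ⧸ U') with hm
  have hmpos : 0 < m := Nat.card_pos
  refine ⟨m, hmpos, ?_⟩
  have h1 : ((⟨u, hu⟩ ^ m : C) : C ⧸ U') = 1 := by
    rw [QuotientGroup.mk_pow, hm, pow_card_eq_one']
  have h2 : (⟨u, hu⟩ ^ m : C) ∈ U' := (QuotientGroup.eq_one_iff _).mp h1
  have h3 : C.subtype (⟨u, hu⟩ ^ m) ∈ (U : Subgroup (FiniteAdeleRing (𝓞 K) K)ˣ) := Subgroup.mem_comap.mp h2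
  simpa using h3

/-- A simultaneous open subgroup for finitely many open conditions. [folklore] -/
theorem exists_openSubgroup_forall {G : Type*} [Group G] [TopologicalSpace G] [ContinuousMul G]
    {ι : Type} [Finite ι] {P : ι → G → Prop} (h : ∀ i, ∃ U : OpenSubgroup G, ∀ u ∈ U, P i u) :
    ∃ U : OpenSubgroup G, ∀ u ∈ U, ∀ i, P i u := by
  classical
  choose U hU using h
  haveI := Fintype.ofFinite ι
  have key : ∀ s : Finset ι, ∃ V : OpenSubgroup G, ∀ u ∈ V, ∀ i ∈ s, P i u := by
    intro s
    induction s using Finset.induction_on with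
    | empty => exact ⟨⊤, fun u _ i hi => absurd hi (Finset.notMem_empty i)⟩
    | insert a s ha ih =>
      obtain ⟨V, hV⟩ := ih
      refine ⟨U a ⊓ V, fun u hu i hi => ?_⟩
      rcases Finset.mem_insert.mp hi with rfl | hi
      · exact hU i u hu.1
      · exact hV u hu.2 i hi
  obtain ⟨V, hV⟩ := key Finset.univ
  exact ⟨V, fun u hu i => hV u hu i (Finset.mem_univ i)⟩

end Compact

end Literature.NumberTheory.Automorphic.Meyer
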